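import Summits.QuantumFields.BalabanUV.Beta.GAN24.FibreDFTDictionary
import Summits.QuantumFields.BalabanUV.Beta.GAN24.FibreGaffney
import Summits.QuantumFields.BalabanUV.Beta.GAN24.CapacitanceSolve
import Summits.QuantumFields.BalabanUV.Beta.GAN24.CombesThomasFibreStep

/-!
# `BalabanUV.Beta.GAN24.AliasObjects` — binder row G-an2-4 / (CONV-C), road P1-fibre, typer row **P1-T00** (nodes N12o/N07o of
# `GAN24/Formal/DAG.md` v2): the CLOSED-FORM ALIAS OBJECTS of `SKELETON-P1.md` S1a/S1b′/S1c — DEFINITIONS ONLY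

NOT IN PRINT; OUR PROOF ATTEMPT.  HONEST FRAMING (cell contract, verbatim): «discharging `BetaPertH` makes Bałaban's UV stability
UNCONDITIONAL — a real constructive-QFT result; it is NOT the continuum limit and NOT the Clay problem.»  HONEST DEPENDENCY (verbatim):
«continuum YM on T⁴ ⇐ BetaPertH ∧ nine spine estimates (0/9 proved); BetaPertH ⇐ (D1) ∧ (D4) ∧ CAP+tail; G-an2-4 gates asym, D1 and
NE2/3/4.»  [folklore] DEFINITIONS over the cell's typed objects + `rfl`/`simp` unfolding lemmas + the real-zone conjugation facts; NO
estimate, NO cited fact, NO `def … : Prop` hypothesis, NO wall binder, NO invertibility claim.  NOT summit progress; nothing of (CONV-C)'s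
K-slot is discharged here.

## What this module is for
The explicit per-fibre solution S1b′ (`GAN24/FibreBlockSolve`, `GAN24/CapacitanceSolve`) makes every downstream ESTIMATE of road P1 (rows
L08a/b/f, L09a/b, L11a/b of `DAG.md` v2) a statement about CLOSED-FORM alias objects — the alias sums `𝒫, 𝓋, 𝓌ᵀ`, the bordered capacitance
matrix `Cap(p)`, the reading/source weights and the closed-form fibre function — whose DEFINITIONS need no identification theorem.  This
module transcribes them from gan24-p1's validated executable specification `HOME/b2b-balaban-gan24-p1/diag/kkt_fourier.py: kmat_closed`
(agreement with the arrow system 1.1e-14 and with the direct transcription of `BlochFibreMatrix.resid` 2e-13, `SKELETON-P1.md` §7(a) —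
DIAGNOSTIC numbers, they enter no statement), over a general dimension `D` (applied at `D = d+1`), COMPLEX coarse momentum `p` (every
`conj` of the spec replaced by the holomorphic reflection `k ↦ −k`, so the objects are strip-ready; at real `p` the two agree, §9 below),
block side `N`, decimation side `M`.  The identification `kFib … p = kFibClosed … p` on the regular zone is row P1-L05b, NOT this file;
the `p = 0` branch of `kmat_closed` (its `else` branch: `φ` from EL₀, `c = 0`, `Â(0)` from the Q rows) is left to row P1-L05(b).

## Transcription table  (`kmat_closed` name ↦ Lean name; `m : TorusSite D N`, fine momentum `kAl N p m = FibreDFT.kFine p m = (p + 2π·repZ m)/N`)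
`K[m]` ↦ `kAl N p m` · `geom_sum(z, n)` ↦ `gs z n` · `sd[m,κ]` ↦ `sAl N p m κ` · `S[m]` ↦ `SAl N p m` · `sdb` ↦ `sbAl` · `conj(S)` ↦ `SbAl` ·
`chi` ↦ `chiAl` · `w` ↦ `wAl` · `dh[m]` ↦ `dAl N p m = dhat (kAl N p m)` · `dhb[m]` ↦ `dbAl N p m = dflat (kAl N p m)` · `L[m]` ↦ `LAl N p m = lapSym (kAl N p m)` ·
`Pf`/`Pg` ↦ `piPerp` · `reg` ↦ `reg N p` · `P` ↦ `capP N p` · `v` ↦ `capV N p` · `wv` ↦ `capW N p` · `Cap` ↦ `cap N p` (on `Fin D ⊕ Unit`) ·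
`SM[m]` ↦ `SMAl N M p m` · `sM[m,κ]` ↦ `sMAl N M p m κ` · `Wread[(κ,ρ)][m]` ↦ `readW N M p m κ ρ` · `conj(Wread)/N^D` ↦ `srcW N M p m κ ρ` ·
`fhat` (field source `(l, ρ′)`) ↦ `fhatF N M p l ρ′` · `chat` (multiplier source `l`) ↦ `eVec l` · `r_phi` ↦ `srcPhi` · `r_c` ↦ `srcC` ·
`sol = solve(Cap, (r_phi, r_c))` ↦ `capSol` (via `(cap N p)⁻¹ *ᵥ ·`; `Matrix.inv` is total, NO invertibility is asserted) · `phi` ↦ `phiSol` · `c` ↦ `cSol` ·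
`g[m]` ↦ `gAl` · `Ahat[m]` ↦ `Ahat` (= `FibreBlockSolve.Asol` BY NAME) · `kk` with the unit factors `sf`, `sm` ↦ `kFibClosedW` / `kFibClosed`
(argument list of `CombesThomasFibreStep.kFibW` / `kFib`; the fine-point leg sums of `kFibW` over `legSet`/`legPt` with weights `legW`, `legScale`
ARE the `M`-level reading sums `readW`/`srcW` — to be proved in row P1-L05b; the block phases `cphase (legOff …)` of `kFibW` split as
`e^{ip·quo N P} · pw k_m (repZ (proj N P)) = e^{i k_m·P}`, absorbed in `readW`/`srcW` for field legs and kept as `cphase (± quo N (M•x′))` for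
multiplier legs).  RAW FRAME DATA for row L08: `lam N p = N²·L₀`, `uRaw N p = Σ₀∂₀` (normalisation left to L08a).
-/

noncomputable section

open Complex Finset Matrix
open scoped BigOperators ComplexConjugate Real
open Literature.Probability.LatticeModels (TorusSite)
open Literature.MathematicalPhysics.QuantumFieldTheory
open Literature.MathematicalPhysics.QuantumFieldTheory.LatticeForm (repZ quo)
open Literature.MathematicalPhysics.QuantumFieldTheory.Balaban1983to89
open Literature.MathematicalPhysics.QuantumFieldTheory.Balaban1983to89.Beta
open B4Strip (ofRealVec)
open FibreInverseDecay (cphase)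
open OneStepResolventKernel (Fib)
open Summit.QuantumFields.BalabanUV.Beta.GAN24.FibreSymbols (pw dhat dflat lapSym)
open Summit.QuantumFields.BalabanUV.Beta.GAN24.FibreBlockSolve (dot Asol musol)
open Summit.QuantumFields.BalabanUV.Beta.GAN24.FibreDFT (kFine)

namespace Summit.QuantumFields.BalabanUV.Beta.GAN24.AliasObjects

variable {D : ℕ}

/-! ## §1 Fine momenta, geometric sums, alias weights (spec (a)) -/

/-- [folklore] The fine momentum of the alias class `m` above `p`: `kAl N p m = (p + 2π·repZ m)/N` — `FibreDFT.kFine` BY NAME (block side explicit). -/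
abbrev kAl (N : ℕ) [NeZero N] (p : Fin D → ℂ) (m : TorusSite D N) : Fin D → ℂ := kFine p m

/-- [folklore] Unfolding: `kAl N p m i = (p i + 2π·repZ m i)/N`. -/
theorem kAl_apply (N : ℕ) [NeZero N] (p : Fin D → ℂ) (m : TorusSite D N) (i : Fin D) :
    kAl N p m i = (p i + 2 * π * (repZ m i : ℂ)) / (N : ℂ) := rfl

/-- [folklore] The geometric sum `gs z n = Σ_{t<n} e^{izt}` (spec `geom_sum`; the explicit-sum form of `GAN24/AliasWeights`). -/
def gs (z : ℂ) (n : ℕ) : ℂ := ∑ t ∈ Finset.range n, cexp (I * z * t)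

/-- [folklore] Directional box weight `s_κ(m) = Σ_{t<N} e^{i k_{m,κ} t}` (spec `sd`). -/
def sAl (N : ℕ) [NeZero N] (p : Fin D → ℂ) (m : TorusSite D N) (κ : Fin D) : ℂ := gs (kAl N p m κ) N
/-- [folklore] Box factor `S(m) = Π_i s_i(m)` (spec `S`). -/
def SAl (N : ℕ) [NeZero N] (p : Fin D → ℂ) (m : TorusSite D N) : ℂ := ∏ i, sAl N p m i
/-- [folklore] FLAT twin `s♭_κ(m) = Σ_{t<N} e^{−i k_{m,κ} t}` (spec `sdb`; holomorphic in `p`, `= conj s_κ(m)` at real `p`). -/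
def sbAl (N : ℕ) [NeZero N] (p : Fin D → ℂ) (m : TorusSite D N) (κ : Fin D) : ℂ := gs (-kAl N p m κ) N
/-- [folklore] FLAT box factor `S♭(m) = Π_i s♭_i(m)` (spec `conj(S)` at real `p`). -/
def SbAl (N : ℕ) [NeZero N] (p : Fin D → ℂ) (m : TorusSite D N) : ℂ := ∏ i, sbAl N p m i
/-- [folklore] `χ̂(m) = S♭(m)/N^D` (spec `chi`): the box-DFT amplitude of the constant `1`. -/
def chiAl (N : ℕ) [NeZero N] (p : Fin D → ℂ) (m : TorusSite D N) : ℂ := SbAl N p m / (N : ℂ) ^ D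
/-- [folklore] The alias weight `w_m = S(m)·χ̂(m)` (spec `w`; `= ‖S(m)‖²/N^D ≥ 0` at real `p`). -/
def wAl (N : ℕ) [NeZero N] (p : Fin D → ℂ) (m : TorusSite D N) : ℂ := SAl N p m * chiAl N p m

/-! ## §2 Symbols BY NAME, the transverse projector, the regular set (spec (b)) -/

/-- [folklore] `∂_m = ∂̂(k_m)` (`FibreSymbols.dhat` BY NAME). -/
abbrev dAl (N : ℕ) [NeZero N] (p : Fin D → ℂ) (m : TorusSite D N) : Fin D → ℂ := dhat (kAl N p m)
/-- [folklore] `∂♭_m = ∂̂♭(k_m)` (`FibreSymbols.dflat` BY NAME). -/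
abbrev dbAl (N : ℕ) [NeZero N] (p : Fin D → ℂ) (m : TorusSite D N) : Fin D → ℂ := dflat (kAl N p m)
/-- [folklore] `L_m = |∂̂|²(k_m)` (`FibreSymbols.lapSym` BY NAME). -/
abbrev LAl (N : ℕ) [NeZero N] (p : Fin D → ℂ) (m : TorusSite D N) : ℂ := lapSym (kAl N p m)

/-- [folklore] The transverse projection of a block vector: `(Π⊥ f)_κ = f_κ − ∂_κ (∂♭·f)/L` (spec `Pf`, `Pg`). -/
def piPerp (dd db : Fin D → ℂ) (L : ℂ) (f : Fin D → ℂ) : Fin D → ℂ := fun κ => f κ - dd κ * dot db f / L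

/-- [folklore] The REGULAR alias classes: `L_m ≠ 0` (spec `reg = ~zero_mode`; all of them unless `(p, m) = (0, 0)` on the real zone). -/
def reg (N : ℕ) [NeZero N] (p : Fin D → ℂ) : Finset (TorusSite D N) := Finset.univ.filter fun m => LAl N p m ≠ 0

/-- [folklore] Membership in the regular set. -/
theorem mem_reg (N : ℕ) [NeZero N] (p : Fin D → ℂ) (m : TorusSite D N) : m ∈ reg N p ↔ LAl N p m ≠ 0 := by
  simp [reg]
/-- [folklore] On the regular zone every alias class is regular. -/
theorem reg_eq_univ (N : ℕ) [NeZero N] (p : Fin D → ℂ) (h : ∀ m, LAl N p m ≠ 0) : reg N p = Finset.univ := by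
  unfold reg
  exact Finset.filter_true_of_mem fun m _ => h m

/-! ## §3 The capacitance matrix (spec (c)) -/

/-- [folklore] `𝒫_{κl} = Σ_{m ∈ reg} w_m/(2L_m) · s_κ(m) · (δ_{κl} − ∂_{mκ}∂♭_{ml}/L_m) · s♭_l(m)` (spec `P`). -/
def capP (N : ℕ) [NeZero N] (p : Fin D → ℂ) : Matrix (Fin D) (Fin D) ℂ := fun κ l =>
  ∑ m ∈ reg N p, wAl N p m / (2 * LAl N p m) * sAl N p m κ *
    ((if κ = l then 1 else 0) - dAl N p m κ * dbAl N p m l / LAl N p m) * sbAl N p m l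

/-- [folklore] `𝓋_κ = Σ_{m ∈ reg} w_m · s_κ(m) · ∂_{mκ} / L_m²` (spec `v`). -/
def capV (N : ℕ) [NeZero N] (p : Fin D → ℂ) : Fin D → ℂ := fun κ => ∑ m ∈ reg N p, wAl N p m * sAl N p m κ * dAl N p m κ / LAl N p m ^ 2

/-- [folklore] `𝓌_l = Σ_{m ∈ reg} w_m · ∂♭_{ml} · s♭_l(m) / L_m²` (spec `wv`). -/
def capW (N : ℕ) [NeZero N] (p : Fin D → ℂ) : Fin D → ℂ := fun l => ∑ m ∈ reg N p, wAl N p m * dbAl N p m l * sbAl N p m l / LAl N p m ^ 2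

/-- [folklore] THE BORDERED CAPACITANCE MATRIX `Cap(p) = [[𝒫, 𝓋],[𝓌ᵀ, 0]]` on `Fin D ⊕ Unit` (spec `Cap`). -/
def cap (N : ℕ) [NeZero N] (p : Fin D → ℂ) : Matrix (Fin D ⊕ Unit) (Fin D ⊕ Unit) ℂ :=
  Matrix.fromBlocks (capP N p) (Matrix.replicateCol Unit (capV N p)) (Matrix.replicateRow Unit (capW N p)) 0

/-- [folklore] Entries of `cap`: the `φφ` block. -/
@[simp] theorem cap_inl_inl (N : ℕ) [NeZero N] (p : Fin D → ℂ) (κ l : Fin D) : cap N p (Sum.inl κ) (Sum.inl l) = capP N p κ l := rfl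
/-- [folklore] Entries of `cap`: the `φc` column. -/
@[simp] theorem cap_inl_inr (N : ℕ) [NeZero N] (p : Fin D → ℂ) (κ : Fin D) (u : Unit) : cap N p (Sum.inl κ) (Sum.inr u) = capV N p κ := rfl
/-- [folklore] Entries of `cap`: the `cφ` row. -/
@[simp] theorem cap_inr_inl (N : ℕ) [NeZero N] (p : Fin D → ℂ) (u : Unit) (l : Fin D) : cap N p (Sum.inr u) (Sum.inl l) = capW N p l := rfl
/-- [folklore] Entries of `cap`: the `cc` corner is `0`. -/
@[simp] theorem cap_inr_inr (N : ℕ) [NeZero N] (p : Fin D → ℂ) (u u' : Unit) : cap N p (Sum.inr u) (Sum.inr u') = 0 := rfl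

/-- [folklore] `cap *ᵥ (φ; c)` on the `φ` rows: `Σ_l 𝒫_{κl} φ_l + 𝓋_κ c`. -/
theorem cap_mulVec_inl (N : ℕ) [NeZero N] (p : Fin D → ℂ) (φ : Fin D → ℂ) (c : Unit → ℂ) (κ : Fin D) :
    (cap N p *ᵥ Sum.elim φ c) (Sum.inl κ) = ∑ l, capP N p κ l * φ l + capV N p κ * c () := by
  simp [cap, Matrix.mulVec, dotProduct, Fintype.sum_sum_type, Matrix.replicateCol_apply, Finset.univ_unique, Finset.sum_singleton]

/-- [folklore] `cap *ᵥ (φ; c)` on the `c` row: `Σ_κ 𝓌_κ φ_κ`. -/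
theorem cap_mulVec_inr (N : ℕ) [NeZero N] (p : Fin D → ℂ) (φ : Fin D → ℂ) (c : Unit → ℂ) (u : Unit) :
    (cap N p *ᵥ Sum.elim φ c) (Sum.inr u) = ∑ κ, capW N p κ * φ κ := by
  simp [cap, Matrix.mulVec, dotProduct, Fintype.sum_sum_type, Matrix.replicateRow_apply]

/-! ## §4 `M`-level reading and source weights (spec (d)) -/

/-- [folklore] `s_{M,κ}(m) = Σ_{t<M} e^{i k_{m,κ} t}` (spec `sM`). -/
def sMAl (N M : ℕ) [NeZero N] (p : Fin D → ℂ) (m : TorusSite D N) (κ : Fin D) : ℂ := gs (kAl N p m κ) M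
/-- [folklore] `S_M(m) = Π_i s_{M,i}(m)` (spec `SM`). -/
def SMAl (N M : ℕ) [NeZero N] (p : Fin D → ℂ) (m : TorusSite D N) : ℂ := ∏ i, sMAl N M p m i
/-- [folklore] FLAT twin `s♭_{M,κ}(m)` (`= conj` at real `p`). -/
def sbMAl (N M : ℕ) [NeZero N] (p : Fin D → ℂ) (m : TorusSite D N) (κ : Fin D) : ℂ := gs (-kAl N p m κ) M
/-- [folklore] FLAT twin `S♭_M(m)`. -/
def SbMAl (N M : ℕ) [NeZero N] (p : Fin D → ℂ) (m : TorusSite D N) : ℂ := ∏ i, sbMAl N M p m i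

/-- [folklore] READING WEIGHT of the field leg `(κ, ρ)` on the alias amplitude `Â_κ(m)`: `e^{i k_m·Mρ} · S_M(m) · s_{M,κ}(m) / M^{D+1}`
(spec `Wread`: block mean ∘ contour mean of the plane wave `e^{i k_m·x}` over the straight contours of the `M`-block at `M•ρ`). -/
def readW (N M : ℕ) [NeZero N] (p : Fin D → ℂ) (m : TorusSite D N) (κ : Fin D) (ρ : Fin D → ℤ) : ℂ :=
  cexp (I * ∑ i, kAl N p m i * ((M : ℂ) * (ρ i : ℂ))) * SMAl N M p m * sMAl N M p m κ / (M : ℂ) ^ (D + 1)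

/-- [folklore] SOURCE WEIGHT of the field leg `(κ, ρ)`: the flat twin of `readW` divided by `N^D` (spec `conj(Wread)/N^D` — the box-DFT
amplitude `FibreDFT.amp` of the leg-averaged unit force). -/
def srcW (N M : ℕ) [NeZero N] (p : Fin D → ℂ) (m : TorusSite D N) (κ : Fin D) (ρ : Fin D → ℤ) : ℂ :=
  cexp (-(I * ∑ i, kAl N p m i * ((M : ℂ) * (ρ i : ℂ)))) * SbMAl N M p m * sbMAl N M p m κ / (M : ℂ) ^ (D + 1) / (N : ℂ) ^ D

/-! ## §5 The closed-form per-fibre solve on the regular zone (spec (e), `kk` loop of `kmat_closed`) -/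

/-- [folklore] Right-hand side of the `φ` capacitance rows: `r_φ = ĉ − Σ_{m ∈ reg} S(m)/(2L_m) · s(m) ⊙ Π⊥_m f̂(m)` (spec `r_phi`). -/
def srcPhi (N : ℕ) [NeZero N] (p : Fin D → ℂ) (fhat : TorusSite D N → Fin D → ℂ) (chat : Fin D → ℂ) : Fin D → ℂ := fun κ =>
  chat κ - ∑ m ∈ reg N p, SAl N p m / (2 * LAl N p m) * sAl N p m κ * piPerp (dAl N p m) (dbAl N p m) (LAl N p m) (fhat m) κ

/-- [folklore] Right-hand side of the `c` capacitance row: `r_c = −Σ_{m ∈ reg} S(m) (∂♭_m·f̂(m)) / L_m²` (spec `r_c`). -/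
def srcC (N : ℕ) [NeZero N] (p : Fin D → ℂ) (fhat : TorusSite D N → Fin D → ℂ) : ℂ := -∑ m ∈ reg N p, SAl N p m * dot (dbAl N p m) (fhat m) / LAl N p m ^ 2

/-- [folklore] `(φ; c) := Cap⁻¹ (r_φ; r_c)` with Mathlib's TOTAL `Matrix.inv` (spec `np.linalg.solve(Cap, …)`); NO invertibility is asserted —
where `cap N p` is singular this is the junk value of `Ring.inverse`. -/
def capSol (N : ℕ) [NeZero N] (p : Fin D → ℂ) (fhat : TorusSite D N → Fin D → ℂ) (chat : Fin D → ℂ) : Fin D ⊕ Unit → ℂ :=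
  (cap N p)⁻¹ *ᵥ Sum.elim (srcPhi N p fhat chat) (fun _ => srcC N p fhat)

/-- [folklore] The constraint multipliers `φ` (spec `phi = sol[:D]`). -/
def phiSol (N : ℕ) [NeZero N] (p : Fin D → ℂ) (fhat : TorusSite D N → Fin D → ℂ) (chat : Fin D → ℂ) : Fin D → ℂ := fun κ => capSol N p fhat chat (Sum.inl κ)
/-- [folklore] The block gauge constant `c` (spec `c = sol[D]`). -/
def cSol (N : ℕ) [NeZero N] (p : Fin D → ℂ) (fhat : TorusSite D N → Fin D → ℂ) (chat : Fin D → ℂ) : ℂ := capSol N p fhat chat (Sum.inr ())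

/-- [folklore] The EL feed of block `m`: `g_m = f̂(m) + χ̂(m) · s♭(m) ⊙ φ` (spec `g`). -/
def gAl (N : ℕ) [NeZero N] (p : Fin D → ℂ) (fhat : TorusSite D N → Fin D → ℂ) (chat : Fin D → ℂ) (m : TorusSite D N) : Fin D → ℂ :=
  fun κ => fhat m κ + chiAl N p m * sbAl N p m κ * phiSol N p fhat chat κ

/-- [folklore] THE FIELD AMPLITUDE `Â(m) = Asol(∂_m, ∂♭_m, g_m, L_m, χ̂(m)·c)` — `FibreBlockSolve.Asol` BY NAME (spec `Ahat = Pg/(2L) + (chi c/L²) dh`). -/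
def Ahat (N : ℕ) [NeZero N] (p : Fin D → ℂ) (fhat : TorusSite D N → Fin D → ℂ) (chat : Fin D → ℂ) (m : TorusSite D N) : Fin D → ℂ :=
  Asol (dAl N p m) (dbAl N p m) (gAl N p fhat chat m) (LAl N p m) (chiAl N p m * cSol N p fhat chat)

/-- [folklore] THE GAUGE MULTIPLIER `μ̂(m) = musol(∂♭_m, g_m, L_m)` — `FibreBlockSolve.musol` BY NAME (not read by any leg; recorded for P1-L05b). -/
def muhat (N : ℕ) [NeZero N] (p : Fin D → ℂ) (fhat : TorusSite D N → Fin D → ℂ) (chat : Fin D → ℂ) (m : TorusSite D N) : ℂ :=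
  musol (dbAl N p m) (gAl N p fhat chat m) (LAl N p m)

/-- [folklore] The unit vector `e_l` (spec `chat[l] = 1`: the unit CONSTRAINT source of the multiplier leg `l`). -/
def eVec (l : Fin D) : Fin D → ℂ := fun κ => if κ = l then 1 else 0

/-- [folklore] The unit FORCE source of the field leg `(l, ρ′)` in alias amplitudes: `f̂(m) = srcW(m, l, ρ′) · e_l` (spec `fhat[:, l] = conj(Wread)/N^D`). -/
def fhatF (N M : ℕ) [NeZero N] (p : Fin D → ℂ) (l : Fin D) (ρ' : Fin D → ℤ) : TorusSite D N → Fin D → ℂ := fun m κ => if κ = l then srcW N M p m l ρ' else 0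

/-! ## §6 The closed-form fibre function with the argument list of `kFibW` / `kFib` -/

section Legs

variable {d : ℕ}

/-- [folklore] **THE CLOSED-FORM FIBRE FUNCTION AT FIXED `(N, M, s_f, s_m)`** — same argument list as `CombesThomasFibreStep.kFibW`: by leg type,
field–field `s_f² Σ_m readW(m,κ,x′) Â_κ(m)[force (l,y′)]`, field–multiplier `s_f s_m e^{−ip·quo N (M•y′)} Σ_m readW(m,κ,x′) Â_κ(m)[constraint e_l]`,
multiplier–field `s_m s_f e^{ip·quo N (M•x′)} φ_κ[force (l,y′)]`, multiplier–multiplier `s_m² e^{ip·(quo N (M•x′) − quo N (M•y′))} φ_κ[constraint e_l]`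
(spec `kk` with `scale ⊗ scale`; regular zone only — see the header for the `p = 0` branch). -/
def kFibClosedW (N : ℕ) [NeZero N] (M : ℕ) (sf sm : ℝ) (a : Fib d) (x' : Fin (d + 1) → ℤ) (b : Fib d) (y' : Fin (d + 1) → ℤ) :
    (Fin (d + 1) → ℂ) → ℂ := fun p =>
  match a, b with
  | Sum.inl κ, Sum.inl l => ((sf * sf : ℝ) : ℂ) * ∑ m, readW N M p m κ x' * Ahat N p (fhatF N M p l y') 0 m κ
  | Sum.inl κ, Sum.inr l => ((sf * sm : ℝ) : ℂ) * cphase (-quo N ((M : ℤ) • y')) p * ∑ m, readW N M p m κ x' * Ahat N p 0 (eVec l) m κ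
  | Sum.inr κ, Sum.inl l => ((sm * sf : ℝ) : ℂ) * cphase (quo N ((M : ℤ) • x')) p * phiSol N p (fhatF N M p l y') 0 κ
  | Sum.inr κ, Sum.inr l => ((sm * sm : ℝ) : ℂ) * cphase (quo N ((M : ℤ) • x') - quo N ((M : ℤ) • y')) p * phiSol N p 0 (eVec l) κ

/-- [folklore] **THE CLOSED-FORM STEP FIBRE FUNCTION** — same argument list as `CombesThomasFibreStep.kFib`:
`kFibClosed Lc s_f s_m j := kFibClosedW (Lc^(j+1)) (Lc^j) (s_f j) (s_m j)`.  Row P1-L05b: `kFib … p = kFibClosed … p` on `{p | ∀ m, m ∈ reg}`. -/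
def kFibClosed (Lc : ℕ) [NeZero Lc] (sf sm : ℕ → ℝ) (j : ℕ) (a : Fib d) (x' : Fin (d + 1) → ℤ) (b : Fib d) (y' : Fin (d + 1) → ℤ) :
    (Fin (d + 1) → ℂ) → ℂ :=
  kFibClosedW (Lc ^ (j + 1)) (Lc ^ j) (sf j) (sm j) a x' b y'

end Legs

/-! ## §7 Raw frame data for row L08 (spec (f)) -/

/-- [folklore] `λ = N²·L₀` with `L₀ = L(k_0) = L(p/N)` (∈ [(4/π²)|p|², |p|²] at real `p ∈ BZ` by row L07 — not proved here). -/
def lam (N : ℕ) [NeZero N] (p : Fin D → ℂ) : ℂ := (N : ℂ) ^ 2 * LAl N p 0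

/-- [folklore] The un-normalised frame vector `u_κ = s_κ(0)·∂_{0κ}` (`∝ Σ₀∂₀`; normalisation left to row L08a). -/
def uRaw (N : ℕ) [NeZero N] (p : Fin D → ℂ) : Fin D → ℂ := fun κ => sAl N p 0 κ * dAl N p 0 κ

/-! ## §8 Unfolding lemmas and the bridge to `GAN24/CapacitanceSolve` (the abstract arrow system INSTANTIATED on the alias data) -/

/-- [folklore] `∂♭_m · ∂_m = L_m` (`FibreBlockSolve.dot` vs `FibreSymbols.lapSym`: the same sum up to the order of the factors). -/
theorem dot_dbAl_dAl (N : ℕ) [NeZero N] (p : Fin D → ℂ) (m : TorusSite D N) : dot (dbAl N p m) (dAl N p m) = LAl N p m := by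
  show (∑ κ, dflat (kAl N p m) κ * dhat (kAl N p m) κ) = ∑ κ, dhat (kAl N p m) κ * dflat (kAl N p m) κ
  exact Finset.sum_congr rfl fun κ _ => mul_comm _ _

/-- [folklore] THE ALIAS FIBRE DATA as an instance of `CapacitanceSolve.Fibre` on the regular zone: border weights
`wE = χ̂·s♭`, `wG = χ̂`, `wM = S`, `wQ = S·s` (S1a). -/
def fibreAl (N : ℕ) [NeZero N] (p : Fin D → ℂ) (h : ∀ m, LAl N p m ≠ 0) : CapacitanceSolve.Fibre D (TorusSite D N) where
  dd := dAl N p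
  db := dbAl N p
  L := LAl N p
  wE m κ := chiAl N p m * sbAl N p m κ
  wG := chiAl N p
  wM := SAl N p
  wQ m κ := SAl N p m * sAl N p m κ
  L_ne := h
  dot_db_dd := dot_dbAl_dAl N p

/-- [folklore] `𝒫` is `CapacitanceSolve.capP` of the alias fibre data. -/
theorem capP_eq (N : ℕ) [NeZero N] (p : Fin D → ℂ) (h : ∀ m, LAl N p m ≠ 0) (κ l : Fin D) : capP N p κ l = CapacitanceSolve.capP (fibreAl N p h) κ l := by
  simp only [capP, CapacitanceSolve.capP, CapacitanceSolve.capPm, fibreAl, reg_eq_univ N p h, wAl]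
  exact Finset.sum_congr rfl fun m _ => by ring

/-- [folklore] `𝓋` is `CapacitanceSolve.capV` of the alias fibre data. -/
theorem capV_eq (N : ℕ) [NeZero N] (p : Fin D → ℂ) (h : ∀ m, LAl N p m ≠ 0) (κ : Fin D) : capV N p κ = CapacitanceSolve.capV (fibreAl N p h) κ := by
  simp only [capV, CapacitanceSolve.capV, fibreAl, reg_eq_univ N p h, wAl]
  exact Finset.sum_congr rfl fun m _ => by ring

/-- [folklore] `𝓌` is `CapacitanceSolve.capW` of the alias fibre data. -/
theorem capW_eq (N : ℕ) [NeZero N] (p : Fin D → ℂ) (h : ∀ m, LAl N p m ≠ 0) (l : Fin D) : capW N p l = CapacitanceSolve.capW (fibreAl N p h) l := by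
  simp only [capW, CapacitanceSolve.capW, fibreAl, reg_eq_univ N p h, wAl]
  exact Finset.sum_congr rfl fun m _ => by ring

/-- [folklore] `r_φ = ĉ − srcQ` of the abstract capacitance system (gauge sources `γ = 0`). -/
theorem srcPhi_eq (N : ℕ) [NeZero N] (p : Fin D → ℂ) (h : ∀ m, LAl N p m ≠ 0) (fhat : TorusSite D N → Fin D → ℂ) (chat : Fin D → ℂ) (κ : Fin D) :
    srcPhi N p fhat chat κ = chat κ - CapacitanceSolve.srcQ (fibreAl N p h) fhat 0 κ := by
  simp only [srcPhi, CapacitanceSolve.srcQ, fibreAl, reg_eq_univ N p h, piPerp, Pi.zero_apply, zero_div, zero_mul, add_zero]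
  congr 1
  exact Finset.sum_congr rfl fun m _ => by ring

/-- [folklore] `r_c = −srcM` of the abstract capacitance system (average source `ρ = 0`). -/
theorem srcC_eq (N : ℕ) [NeZero N] (p : Fin D → ℂ) (h : ∀ m, LAl N p m ≠ 0) (fhat : TorusSite D N → Fin D → ℂ) :
    srcC N p fhat = -CapacitanceSolve.srcM (fibreAl N p h) fhat := by
  simp only [srcC, CapacitanceSolve.srcM, fibreAl, reg_eq_univ N p h]

/-- [folklore] `Â(m)` is the per-block solution `CapacitanceSolve.Ablk` fed by `(φ, c) = (phiSol, cSol)` (gauge sources `γ = 0`). -/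
theorem Ahat_eq (N : ℕ) [NeZero N] (p : Fin D → ℂ) (h : ∀ m, LAl N p m ≠ 0) (fhat : TorusSite D N → Fin D → ℂ) (chat : Fin D → ℂ) (m : TorusSite D N) :
    Ahat N p fhat chat m = CapacitanceSolve.Ablk (fibreAl N p h) fhat 0 (phiSol N p fhat chat) (cSol N p fhat chat) m := by
  rw [CapacitanceSolve.Ablk, CapacitanceSolve.gfeed, Pi.zero_apply, zero_add]
  rfl

/-- [folklore] `μ̂(m)` is `CapacitanceSolve.mublk` fed by `φ = phiSol`. -/
theorem muhat_eq (N : ℕ) [NeZero N] (p : Fin D → ℂ) (h : ∀ m, LAl N p m ≠ 0) (fhat : TorusSite D N → Fin D → ℂ) (chat : Fin D → ℂ) (m : TorusSite D N) :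
    muhat N p fhat chat m = CapacitanceSolve.mublk (fibreAl N p h) fhat (phiSol N p fhat chat) m := by
  rw [CapacitanceSolve.mublk]
  rfl

/-- [folklore] THE CAPACITANCE SYSTEM IN MATRIX FORM: `(φ, c)` solves `CapacitanceSolve.CapSolves` (sources `(f̂, 0, 0, ĉ)`) iff
`cap *ᵥ (φ; c) = (r_φ; r_c)`. -/
theorem capSolves_iff_mulVec (N : ℕ) [NeZero N] (p : Fin D → ℂ) (h : ∀ m, LAl N p m ≠ 0) (fhat : TorusSite D N → Fin D → ℂ) (chat : Fin D → ℂ) (φ : Fin D → ℂ) (c : ℂ) :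
    CapacitanceSolve.CapSolves (fibreAl N p h) fhat 0 0 chat φ c ↔
      cap N p *ᵥ Sum.elim φ (fun _ => c) = Sum.elim (srcPhi N p fhat chat) (fun _ => srcC N p fhat) := by
  rw [CapacitanceSolve.CapSolves, funext_iff, Sum.forall]
  simp only [cap_mulVec_inl, cap_mulVec_inr, Sum.elim_inl, Sum.elim_inr, srcPhi_eq N p h, srcC_eq N p h, capP_eq N p h,
    capV_eq N p h, capW_eq N p h, neg_zero, zero_sub, Unique.forall_iff]

/-- [folklore] IF `cap N p` is invertible (NOT asserted here — rows L08d/L08e), the closed-form pair `(phiSol, cSol)` solves the capacitance system. -/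
theorem capSolves_closed (N : ℕ) [NeZero N] (p : Fin D → ℂ) (h : ∀ m, LAl N p m ≠ 0) (hdet : IsUnit (cap N p).det) (fhat : TorusSite D N → Fin D → ℂ) (chat : Fin D → ℂ) :
    CapacitanceSolve.CapSolves (fibreAl N p h) fhat 0 0 chat (phiSol N p fhat chat) (cSol N p fhat chat) := by
  rw [capSolves_iff_mulVec N p h]
  have e : Sum.elim (phiSol N p fhat chat) (fun _ => cSol N p fhat chat) = capSol N p fhat chat := by
    funext i; rcases i with κ | ⟨⟩ <;> rfl
  rw [e, capSol, Matrix.mulVec_mulVec, Matrix.mul_nonsing_inv _ hdet, Matrix.one_mulVec]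

/-- [folklore] … and then `(Â, μ̂, φ, c)` SOLVES THE ARROW SYSTEM with sources `(f̂, 0, 0, ĉ)` (`CapacitanceSolve.arrow_of_cap` BY NAME). -/
theorem arrowSolves_closed (N : ℕ) [NeZero N] (p : Fin D → ℂ) (h : ∀ m, LAl N p m ≠ 0) (hdet : IsUnit (cap N p).det) (fhat : TorusSite D N → Fin D → ℂ) (chat : Fin D → ℂ) :
    CapacitanceSolve.ArrowSolves (fibreAl N p h) fhat 0 0 chat (Ahat N p fhat chat) (muhat N p fhat chat)
      (phiSol N p fhat chat) (cSol N p fhat chat) := by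
  have hA : Ahat N p fhat chat = CapacitanceSolve.Ablk (fibreAl N p h) fhat 0 (phiSol N p fhat chat) (cSol N p fhat chat) :=
    funext fun m => Ahat_eq N p h fhat chat m
  have hμ : muhat N p fhat chat = CapacitanceSolve.mublk (fibreAl N p h) fhat (phiSol N p fhat chat) :=
    funext fun m => muhat_eq N p h fhat chat m
  rw [hA, hμ]
  exact CapacitanceSolve.arrow_of_cap _ (capSolves_closed N p h hdet fhat chat)

/-! ## §9 Real-zone conjugation facts (`p` with `conj (p μ) = p μ`, e.g. `p = ofRealVec q`) -/

/-- [folklore] `ofRealVec q` is conjugation-invariant. -/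
theorem conj_ofRealVec (q : Fin D → ℝ) (μ : Fin D) : conj (ofRealVec q μ) = ofRealVec q μ := by
  simp [ofRealVec]

/-- [folklore] Conjugating a geometric sum reflects the (real) argument: `conj (gs z n) = gs (−z) n` when `conj z = z`. -/
theorem conj_gs {z : ℂ} (hz : conj z = z) (n : ℕ) : conj (gs z n) = gs (-z) n := by
  unfold gs
  rw [map_sum]
  refine Finset.sum_congr rfl fun t _ => ?_
  rw [← Complex.exp_conj, map_mul, map_mul, Complex.conj_I, hz, map_natCast]
  congr 1
  ring


/-- [folklore] At real `p`: `s♭_κ(m) = conj s_κ(m)`. -/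
theorem sbAl_eq_conj {N : ℕ} [NeZero N] {p : Fin D → ℂ} (hp : ∀ μ, conj (p μ) = p μ) (m : TorusSite D N) (κ : Fin D) : sbAl N p m κ = conj (sAl N p m κ) := by
  unfold sbAl sAl
  rw [conj_gs (FibreDFTDictionary.conj_kFine hp m κ)]

/-- [folklore] At real `p`: `S♭(m) = conj S(m)`. -/
theorem SbAl_eq_conj {N : ℕ} [NeZero N] {p : Fin D → ℂ} (hp : ∀ μ, conj (p μ) = p μ) (m : TorusSite D N) : SbAl N p m = conj (SAl N p m) := by
  simp only [SbAl, SAl, map_prod, sbAl_eq_conj hp]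

/-- [folklore] At real `p`: `s♭_{M,κ}(m) = conj s_{M,κ}(m)`. -/
theorem sbMAl_eq_conj {N : ℕ} [NeZero N] {p : Fin D → ℂ} (hp : ∀ μ, conj (p μ) = p μ) (M : ℕ) (m : TorusSite D N) (κ : Fin D) :
    sbMAl N M p m κ = conj (sMAl N M p m κ) := by
  unfold sbMAl sMAl
  rw [conj_gs (FibreDFTDictionary.conj_kFine hp m κ)]

/-- [folklore] At real `p`: `S♭_M(m) = conj S_M(m)`. -/
theorem SbMAl_eq_conj {N : ℕ} [NeZero N] {p : Fin D → ℂ} (hp : ∀ μ, conj (p μ) = p μ) (M : ℕ) (m : TorusSite D N) : SbMAl N M p m = conj (SMAl N M p m) := by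
  simp only [SbMAl, SMAl, map_prod, sbMAl_eq_conj hp]

/-- [folklore] At real `p`: `χ̂(m) = conj S(m) / N^D`. -/
theorem chiAl_eq_conj {N : ℕ} [NeZero N] {p : Fin D → ℂ} (hp : ∀ μ, conj (p μ) = p μ) (m : TorusSite D N) : chiAl N p m = conj (SAl N p m) / (N : ℂ) ^ D := by
  rw [chiAl, SbAl_eq_conj hp]

/-- [folklore] At real `p`: THE ALIAS WEIGHT IS `‖S(m)‖²/N^D`, a nonnegative real. -/
theorem wAl_eq_normSq {N : ℕ} [NeZero N] {p : Fin D → ℂ} (hp : ∀ μ, conj (p μ) = p μ) (m : TorusSite D N) :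
    wAl N p m = ((Complex.normSq (SAl N p m) / (N : ℝ) ^ D : ℝ) : ℂ) := by
  rw [wAl, chiAl_eq_conj hp, ← mul_div_assoc, Complex.mul_conj]
  simp only [Complex.ofReal_div, Complex.ofReal_pow, Complex.ofReal_natCast]

/-- [folklore] At real `p`: `0 ≤ Re w_m` and `Im w_m = 0`. -/
theorem wAl_re_nonneg {N : ℕ} [NeZero N] {p : Fin D → ℂ} (hp : ∀ μ, conj (p μ) = p μ) (m : TorusSite D N) : 0 ≤ (wAl N p m).re ∧ (wAl N p m).im = 0 := by
  rw [wAl_eq_normSq hp, Complex.ofReal_re, Complex.ofReal_im]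
  exact ⟨div_nonneg (Complex.normSq_nonneg _) (by positivity), rfl⟩

/-- [folklore] At real `p`: `∂♭_m = conj ∂_m` (`FibreGaffney.dflat_eq_conj_dhat` BY NAME). -/
theorem dbAl_eq_conj {N : ℕ} [NeZero N] {p : Fin D → ℂ} (hp : ∀ μ, conj (p μ) = p μ) (m : TorusSite D N) (κ : Fin D) : dbAl N p m κ = conj (dAl N p m κ) :=
  FibreGaffney.dflat_eq_conj_dhat (FibreDFTDictionary.conj_kFine hp m) κ

/-- [folklore] At real `p`: `L_m` is real, `L_m = Σ_κ ‖∂_{mκ}‖²` (`FibreGaffney.lapSym_eq_sum_normSq` BY NAME). -/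
theorem LAl_eq_sum_normSq {N : ℕ} [NeZero N] {p : Fin D → ℂ} (hp : ∀ μ, conj (p μ) = p μ) (m : TorusSite D N) :
    LAl N p m = ((∑ κ, Complex.normSq (dAl N p m κ) : ℝ) : ℂ) :=
  FibreGaffney.lapSym_eq_sum_normSq (FibreDFTDictionary.conj_kFine hp m)

/-- [folklore] At real `p`: the source weight is the conjugate reading weight over `N^D` (spec `fhat = conj(Wread)/N^D`). -/
theorem srcW_eq_conj {N : ℕ} [NeZero N] {p : Fin D → ℂ} (hp : ∀ μ, conj (p μ) = p μ) (M : ℕ) (m : TorusSite D N) (κ : Fin D) (ρ : Fin D → ℤ) :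
    srcW N M p m κ ρ = conj (readW N M p m κ ρ) / (N : ℂ) ^ D := by
  have hw : conj (∑ i, kAl N p m i * ((M : ℂ) * (ρ i : ℂ))) = ∑ i, kAl N p m i * ((M : ℂ) * (ρ i : ℂ)) := by
    rw [map_sum]
    exact Finset.sum_congr rfl fun i _ => by rw [map_mul, map_mul, FibreDFTDictionary.conj_kFine hp, map_natCast, map_intCast]
  simp only [srcW, readW, map_div₀, map_mul, map_pow, map_natCast, ← Complex.exp_conj, Complex.conj_I, hw, SbMAl_eq_conj hp,
    sbMAl_eq_conj hp, neg_mul]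

end Summit.QuantumFields.BalabanUV.Beta.GAN24.AliasObjects

end
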